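import Summits.Ventures.HodgeRepro2.T7SupportBergmanOneVectorMonomial
import Summits.Ventures.HodgeRepro2.T7SupportDenseRegularPoint

/-!
# `u_A = zⁿ`: when `hq` holds a dense subset meets the regular non-vanishing locus; when it fails, `Φ_q ≡ 0`
(support, seat p1)

The two faces of the `K`-type `q = −(k+2m)` for `u_A = zⁿ` (`T7SupportBergmanOneVectorMonomial`:
`Φ_{−(k+2m)}(γ) = c_m ⟨π_k(γ h) zᵐ, zⁿ⟩_k`, `c_m` the `m`-th coefficient of `π_k(h⁻¹) zⁿ`):

* **`c_m = 0 ⇒ Φ_{−(k+2m)} ≡ 0`** (`monomialFourierCoeff_eq_zero_of_coeff_eq_zero`): the coefficient `c_m` does not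
  depend on `γ`, so when `hq` fails at a place the orbital integral of the one-vector `f` vanishes there for EVERY `γ` —
  neither a regular `γ₀ ≠ 1` nor the dense-set lemma rescues it (t7-crit-1's record, STATUS l. 15260 (ii));
* **`c_m ≠ 0 ⇒` every dense `S ⊆ SU(1,1)` contains a regular `γ₀` with `Φ_{−(k+2m)}(γ₀) ≠ 0`**
  (`exists_mem_dense_regular_monomialFourierCoeff_ne_zero`, `exists_mem_dense_regular_torus_orbital_monomial_ne_zero`):
  `Φ` is continuous in `γ` (`continuous_monomialFourierCoeff`) and non-zero at `γ = 1`, so row 680's general-`F` lemma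
  applies — row 702 for an arbitrary `K`-type.

Explicit model only; nothing about the adelic group, the global invariant, or any period.
Blind lane: Mathlib + the HodgeRepro2 prefix only; no sorry; axioms ⊆ {propext, Classical.choice, Quot.sound}.
-/

namespace Summit.Ventures.HodgeRepro2.T7SupportBergmanOneVectorMonomialRegularPoint

open MeasureTheory Metric
open T5SU11Unimodular T5SU11Fibration T5BergmanCoefficient T5BergmanMatrixCoeff T5HaarCircle T5BergmanFourier
  T7SupportTwoTorusInvariant T7SupportKappaCartan T7SupportBergmanOneVectorMonomial T7SupportDenseRegularPoint

variable [MeasurableSpace Circle] [BorelSpace Circle]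

/-- **when `hq` fails, the Fourier coefficient vanishes identically in `γ`** -/
theorem monomialFourierCoeff_eq_zero_of_coeff_eq_zero (k : ℕ) (hk : 2 ≤ k) (n : ℕ) (h : SU11) (c : ℕ → ℂ)
    (hc : ∀ z ∈ ball (0 : ℂ) 1, HasSum (fun j => c j * z ^ j) (act k h⁻¹ (fun z => z ^ n) z)) (m : ℕ)
    (h0 : c m = 0) (γ : SU11) : monomialFourierCoeff k n h (-((k + 2 * m : ℕ) : ℤ)) γ = 0 := by
  rw [monomialFourierCoeff_eq k hk n h c hc m γ, h0, zero_mul]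

/-- **the Fourier coefficient is a continuous function of `γ`** -/
theorem continuous_monomialFourierCoeff (k : ℕ) (hk : 2 ≤ k) (n : ℕ) (h : SU11) (c : ℕ → ℂ)
    (hc : ∀ z ∈ ball (0 : ℂ) 1, HasSum (fun j => c j * z ^ j) (act k h⁻¹ (fun z => z ^ n) z)) (m : ℕ) :
    Continuous fun γ : SU11 => monomialFourierCoeff k n h (-((k + 2 * m : ℕ) : ℤ)) γ := by
  have e : (fun γ : SU11 => monomialFourierCoeff k n h (-((k + 2 * m : ℕ) : ℤ)) γ) =
      fun γ => c m * matrixCoeff k (fun w => w ^ m) (fun z => z ^ n) (γ * h) :=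
    funext fun γ => monomialFourierCoeff_eq k hk n h c hc m γ
  rw [e]
  exact continuous_const.mul ((continuous_matrixCoeff_monomial k hk m (fun j => if j = n then 1 else 0)
    (fun z => z ^ n) (fun w _ => hasSum_monomial n w) (integrableOn_monomial k n)).comp
    (continuous_id.mul continuous_const))

/-- **when `hq` holds, every dense subset meets the regular non-vanishing locus of `Φ_{−(k+2m)}`** -/
theorem exists_mem_dense_regular_monomialFourierCoeff_ne_zero (k : ℕ) (hk : 2 ≤ k) (n : ℕ) (h : SU11)
    (c : ℕ → ℂ) (hc : ∀ z ∈ ball (0 : ℂ) 1, HasSum (fun j => c j * z ^ j) (act k h⁻¹ (fun z => z ^ n) z))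
    (m : ℕ) (hm : c m ≠ 0) {S : Set SU11} (hS : Dense S) :
    ∃ γ₀ ∈ S, monomialFourierCoeff k n h (-((k + 2 * m : ℕ) : ℤ)) γ₀ ≠ 0 ∧
      kappa (starRingEnd ℂ) dd (colBasis h) (mat γ₀) ≠ 1 :=
  exists_mem_dense_ne_zero_kappa_ne_one h hS (continuous_monomialFourierCoeff k hk n h c hc m)
    ⟨1, (monomialFourierCoeff_one_ne_zero_iff k hk n h c hc m).2 hm⟩

/-- **a regular point of a dense subset with non-zero two-torus orbital integral of the one-vector `f` of `zⁿ`**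
(first-torus character `u^{k+2n}`, second-torus character `conj(w^{−(k+2m)})`) -/
theorem exists_mem_dense_regular_torus_orbital_monomial_ne_zero (k : ℕ) (hk : 2 ≤ k) (n : ℕ) (h : SU11)
    (c : ℕ → ℂ) (hc : ∀ z ∈ ball (0 : ℂ) 1, HasSum (fun j => c j * z ^ j) (act k h⁻¹ (fun z => z ^ n) z))
    (m : ℕ) (hm : c m ≠ 0) {S : Set SU11} (hS : Dense S) :
    ∃ γ₀ ∈ S, (∫ u : Circle, ∫ w : Circle,
        matrixCoeff k (fun z => z ^ n) (fun z => z ^ n) (rot u * γ₀ * (h * rot w * h⁻¹)) *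
          ((u : ℂ) ^ ((k + 2 * n : ℕ) : ℤ) * (starRingEnd ℂ) ((w : ℂ) ^ (-((k + 2 * m : ℕ) : ℤ))))
        ∂haarCircle ∂haarCircle ≠ 0) ∧
      kappa (starRingEnd ℂ) dd (colBasis h) (mat γ₀) ≠ 1 := by
  obtain ⟨γ₀, hγS, hne, hκ⟩ := exists_mem_dense_regular_monomialFourierCoeff_ne_zero k hk n h c hc m hm hS
  refine ⟨γ₀, hγS, ?_, hκ⟩
  rw [torus_orbital_monomial_eq k n hk h γ₀ _ _, if_pos rfl, one_mul]
  exact hne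

/-- **when `hq` fails, the two-torus orbital integral of the one-vector `f` of `zⁿ` vanishes for every `γ`** -/
theorem torus_orbital_monomial_eq_zero_of_coeff_eq_zero (k : ℕ) (hk : 2 ≤ k) (n : ℕ) (h : SU11) (c : ℕ → ℂ)
    (hc : ∀ z ∈ ball (0 : ℂ) 1, HasSum (fun j => c j * z ^ j) (act k h⁻¹ (fun z => z ^ n) z)) (m : ℕ)
    (h0 : c m = 0) (γ : SU11) (p : ℤ) :
    ∫ u : Circle, ∫ w : Circle,
        matrixCoeff k (fun z => z ^ n) (fun z => z ^ n) (rot u * γ * (h * rot w * h⁻¹)) *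
          ((u : ℂ) ^ p * (starRingEnd ℂ) ((w : ℂ) ^ (-((k + 2 * m : ℕ) : ℤ))))
        ∂haarCircle ∂haarCircle = 0 := by
  rw [torus_orbital_monomial_eq k n hk h γ p _, monomialFourierCoeff_eq_zero_of_coeff_eq_zero k hk n h c hc m h0 γ,
    mul_zero]

end Summit.Ventures.HodgeRepro2.T7SupportBergmanOneVectorMonomialRegularPoint
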